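import Literature.NumberTheory.Automorphic.ArchKirillovODEGL2Complex
import Literature.NumberTheory.Automorphic.ArchKirillovBesselGL2Real
import HarnessLib

/-!
# The Kirillov function of a lowest `SU(2)`-weight vector of `GL₂(K_∞)` along a complex place:
# the holomorphic Casimir equation and its `K`-Bessel solution (Jacquet–Langlands (1970), §6)

Topic `NumberTheory/Automorphic`; namespace `Literature.NumberTheory.Automorphic`. Theorems only (no
definition, no named fact, no instance). The companion of `ArchKirillovODEGL2ComplexKType` (highest
`SU(2)_w`-weight vectors, antiholomorphic Casimir) for LOWEST-weight vectors — needed because the Weyl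
element of the dual side of the Hecke integral exchanges highest and lowest weight vectors of an
`SU(2)_w`-type. Notation: `τ^h(E_{ij}) = τ(E_{ij} ⊗ c) - i τ(E_{ij} ⊗ ic)`,
`τ^a(E_{ij}) = τ(E_{ij} ⊗ c) + i τ(E_{ij} ⊗ ic)`, `H = E₀₀ ⊗ c`, `f(y) = ℓ(τ(exp yH) v)`. A vector `v`
of LOWEST weight `m` (typically `m ≤ 0`) in its `SU(2)_w`-type satisfies

  `(F)`  `τ^h(E₁₀) v = τ^a(E₀₁) v`       (`τ((E₀₁ - E₁₀) ⊗ c) v + i τ((E₀₁ + E₁₀) ⊗ ic) v = 0`),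
  `(T)`  `τ((E₀₀ - E₁₁) ⊗ ic) v = i m v`,

(`(F)` says that the `SU(2)`-lowering operator `τ^h(E₁₀) - τ^a(E₀₁)` kills `v`).

* `placeCasimirHol_apply_of_lowest` — for such `v` with `τ^h(E₀₀) v + τ^h(E₁₁) v = z v`:
  `C^h v = 2 τ^h(E₀₀)² v - (2z + 4) τ^h(E₀₀) v + (z² + 2z) v + 2 τ^h(E₀₁) τ^a(E₀₁) v`;
* `kirillovODE_complex_lowest` — with central characters `μ₁, μ₂` and holomorphic Casimir eigenvalue
  `λ` (`C^h v = λ v`, `ArchPlaceCasimirScalar.exists_placeCasimirHol_eq_smul`):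

    `2 f₂ - (2μ₁ - 2m + 4) f₁ + (μ₁² - iμ₁μ₂ - μ₂²/2 + 2μ₁ + m²/2 - μ₁ m - 2m - λ) f + 2 θ^hθ^a e^{2y} f = 0`

  (the equation of `ArchKirillovODEGL2ComplexKType.kirillovODE_complex_highest` under `m ↦ -m`,
  `μ₂ ↦ -μ₂`, i.e. under complex conjugation of the place);
* `exists_apply_gardingAct_expGLC_eq_besselMode_of_lowest` — hence `ℓ(τ(exp yH) v) =
  c e^{(μ₁-m+1)y/2} besselMode a ν (e^y)` with `λ = (μ₁ - iμ₂)²/2 - 2ν² - 2`, and `…_and_mellin`.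

## References

* H. Jacquet, R. P. Langlands, *Automorphic Forms on GL(2)*, LNM 114 (1970), §6 (PDF pp. 130–150 of
  the held retypeset copy). [JacquetLanglands1970]
* A. W. Knapp, *Representation Theory of Semisimple Groups*, Princeton 1986, Ch. VIII §3. [Knapp1986]
-/

noncomputable section

open MeasureTheory Measure NumberField NumberField.InfinitePlace NumberField.mixedEmbedding IsDedekindDomain Set Filter
open scoped MatrixGroups Topology Classical

namespace Literature.NumberTheory.Automorphic

variable {K : Type} [Field K] [NumberField K]

-- as in `ArchGardingWhittaker`
set_option backward.isDefEq.respectTransparency false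

/-! ### 1. The holomorphic Casimir identity for a lowest-weight vector -/

section EndIdentities

variable {hcpt : isCompact_glFiniteIntegralLevel 2 K}
  {E : Type*} [NormedAddCommGroup E] [NormedSpace ℂ E] [CompleteSpace E]
  {τ : ContRepresentation ℂ (AutomorphyDatum.gl 2 K hcpt).arch.carrier E}
  (hτ : τ.IsStronglyContinuous) (w : {w : InfinitePlace K // IsComplex w})

local notation "𝐜" => ((0, Pi.single w 1) : mixedSpace K)
local notation "𝐜I" => ((0, Pi.single w Complex.I) : mixedSpace K)
local notation "D" => gardingEnd (hcpt := hcpt) (τ := τ) hτ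
local notation "Dh[" i "," j "]" => (gardingEnd (hcpt := hcpt) (τ := τ) hτ (Matrix.single (i : Fin 2) (j : Fin 2) ((0, Pi.single w 1) : mixedSpace K)) -
  Complex.I • gardingEnd (hcpt := hcpt) (τ := τ) hτ (Matrix.single (i : Fin 2) (j : Fin 2) ((0, Pi.single w Complex.I) : mixedSpace K)))
local notation "Da[" i "," j "]" => (gardingEnd (hcpt := hcpt) (τ := τ) hτ (Matrix.single (i : Fin 2) (j : Fin 2) ((0, Pi.single w 1) : mixedSpace K)) +
  Complex.I • gardingEnd (hcpt := hcpt) (τ := τ) hτ (Matrix.single (i : Fin 2) (j : Fin 2) ((0, Pi.single w Complex.I) : mixedSpace K)))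

/-- **The holomorphic Casimir identity for a lowest-weight vector.** If `τ^h(E₀₀) v + τ^h(E₁₁) v = z v`
and `τ^h(E₁₀) v = τ^a(E₀₁) v` (the vector is killed by the `SU(2)`-lowering operator), then
`C^h v = 2 τ^h(E₀₀)² v - (2z + 4) τ^h(E₀₀) v + (z² + 2z) v + 2 τ^h(E₀₁) τ^a(E₀₁) v`. [cite: Knapp1986, Ch. VIII §3] -/
theorem placeCasimirHol_apply_of_lowest (z : ℂ) (v : archGardingSpace hcpt τ)
    (hZ : Dh[0,0] v + Dh[1,1] v = z • v) (hM : Dh[1,0] v = Da[0,1] v) :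
    ∑ i : Fin 2, ∑ j : Fin 2, Dh[i,j] (Dh[j,i] v) =
      (2 : ℂ) • Dh[0,0] (Dh[0,0] v) - (2 * z + 4) • Dh[0,0] v + (z ^ 2 + 2 * z) • v +
        (2 : ℂ) • Dh[0,1] (Da[0,1] v) := by
  have hop : Dh[0,1] * Dh[1,0] - Dh[1,0] * Dh[0,1] = (2 : ℂ) • (Dh[0,0] - Dh[1,1]) :=
    gardingEndHol_xPlus_comm_xMinus hτ w
  have hcomm : Dh[1,1] * Dh[0,0] = Dh[0,0] * Dh[1,1] := gardingEndHol_hOne_mul_hZero hτ w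
  rw [Fin.sum_univ_two, Fin.sum_univ_two, Fin.sum_univ_two]
  -- treat the letters as atoms
  set H0 : Module.End ℂ (archGardingSpace hcpt τ) := Dh[0,0] with hH0d
  set H1 : Module.End ℂ (archGardingSpace hcpt τ) := Dh[1,1] with hH1d
  set Ph : Module.End ℂ (archGardingSpace hcpt τ) := Dh[0,1] with hPhd
  set Mh : Module.End ℂ (archGardingSpace hcpt τ) := Dh[1,0] with hMhd
  set P : Module.End ℂ (archGardingSpace hcpt τ) := Da[0,1] with hPd
  have hH1 : H1 v = z • v - H0 v := by rw [← hZ]; abel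
  have hc : H1 (H0 v) = H0 (H1 v) := by
    have h := congrArg (fun T => T v) hcomm
    simpa only [Module.End.mul_apply] using h
  have hH1sq : H1 (H1 v) = (z ^ 2) • v - (2 * z) • H0 v + H0 (H0 v) := by
    conv_lhs => rw [hH1]
    rw [map_sub, map_smul, hH1, hc, hH1, map_sub, map_smul, smul_sub, pow_two, mul_smul, two_mul, add_smul]
    abel
  have hmp : Mh (Ph v) = Ph (Mh v) - (2 : ℂ) • (H0 v - H1 v) := by
    have h := congrArg (fun T => T v) hop
    simp only [LinearMap.sub_apply, Module.End.mul_apply, LinearMap.smul_apply] at h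
    rw [← h]; abel
  rw [hmp, hM, hH1sq, hH1]
  module

end EndIdentities

/-! ### 2. The differential equation -/

section ODE

variable {hcpt : isCompact_glFiniteIntegralLevel 2 K}
  {E : Type*} [NormedAddCommGroup E] [NormedSpace ℂ E] [CompleteSpace E]
  {τ : ContRepresentation ℂ (AutomorphyDatum.gl 2 K hcpt).arch.carrier E}
  (hτ : τ.IsStronglyContinuous) (w : {w : InfinitePlace K // IsComplex w})

local notation "𝐜" => ((0, Pi.single w 1) : mixedSpace K)
local notation "𝐜I" => ((0, Pi.single w Complex.I) : mixedSpace K)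
local notation "Hc" => Matrix.single (0 : Fin 2) (0 : Fin 2) ((0, Pi.single w 1) : mixedSpace K)
local notation "D" => gardingEnd (hcpt := hcpt) (τ := τ) hτ
local notation "A[" y "]" => gardingAct (hcpt := hcpt) (τ := τ) hτ (expGL ((y : ℝ) • Hc))
local notation "Dh[" i "," j "]" => (gardingEnd (hcpt := hcpt) (τ := τ) hτ (Matrix.single (i : Fin 2) (j : Fin 2) ((0, Pi.single w 1) : mixedSpace K)) -
  Complex.I • gardingEnd (hcpt := hcpt) (τ := τ) hτ (Matrix.single (i : Fin 2) (j : Fin 2) ((0, Pi.single w Complex.I) : mixedSpace K)))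
local notation "Da[" i "," j "]" => (gardingEnd (hcpt := hcpt) (τ := τ) hτ (Matrix.single (i : Fin 2) (j : Fin 2) ((0, Pi.single w 1) : mixedSpace K)) +
  Complex.I • gardingEnd (hcpt := hcpt) (τ := τ) hτ (Matrix.single (i : Fin 2) (j : Fin 2) ((0, Pi.single w Complex.I) : mixedSpace K)))

/-- **The lowest-weight conversions.** If `τ((E₀₀ - E₁₁) ⊗ ic) v = i m v`, `τ(1 ⊗ ic) v = μ₂ v` and
`τ((E₀₁ - E₁₀) ⊗ c) v + i τ((E₀₁ + E₁₀) ⊗ ic) v = 0` (killed by the `SU(2)`-lowering operator), then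
`τ(E₀₀ ⊗ ic) v = ((μ₂ + im)/2) v` and `τ^h(E₁₀) v = τ^a(E₀₁) v`. [folklore] -/
theorem lowest_conversions (μ₂ m : ℂ) (v : archGardingSpace hcpt τ)
    (hT : D (Matrix.single 0 0 𝐜I - Matrix.single 1 1 𝐜I) v = (Complex.I * m) • v)
    (hZ2 : D (Matrix.single 0 0 𝐜I + Matrix.single 1 1 𝐜I) v = μ₂ • v)
    (hF : D (Matrix.single 0 1 𝐜 - Matrix.single 1 0 𝐜) v + Complex.I • D (Matrix.single 0 1 𝐜I + Matrix.single 1 0 𝐜I) v = 0) :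
    D (Matrix.single 0 0 𝐜I) v = ((μ₂ + Complex.I * m) / 2) • v ∧ Dh[1,0] v = Da[0,1] v := by
  refine ⟨?_, ?_⟩
  · rw [gardingEnd_sub, LinearMap.sub_apply] at hT
    rw [gardingEnd_add, LinearMap.add_apply] at hZ2
    have h2 : (2 : ℂ) • D (Matrix.single 0 0 𝐜I) v = μ₂ • v + (Complex.I * m) • v := by
      rw [← hZ2, ← hT, two_smul]; abel
    have h := congrArg (fun u => (2 : ℂ)⁻¹ • u) h2
    simp only [smul_smul, smul_add] at h
    rw [inv_mul_cancel₀ two_ne_zero, one_smul] at h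
    rw [h, ← add_smul]
    congr 1
    ring
  · rw [gardingEnd_sub, gardingEnd_add, LinearMap.sub_apply, LinearMap.add_apply, smul_add] at hF
    rw [LinearMap.sub_apply, LinearMap.add_apply, LinearMap.smul_apply, LinearMap.smul_apply, ← sub_eq_zero]
    have e : D (Matrix.single 1 0 𝐜) v - Complex.I • D (Matrix.single 1 0 𝐜I) v -
        (D (Matrix.single 0 1 𝐜) v + Complex.I • D (Matrix.single 0 1 𝐜I) v) =
        -(D (Matrix.single 0 1 𝐜) v - D (Matrix.single 1 0 𝐜) v +
          (Complex.I • D (Matrix.single 0 1 𝐜I) v + Complex.I • D (Matrix.single 1 0 𝐜I) v)) := by abel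
    rw [e, hF, neg_zero]

/-- **The differential equation of the Kirillov function along a complex place for a lowest-weight
vector of an `SU(2)_w`-type** (torus weight `m`, central characters `μ₁, μ₂`, holomorphic Casimir
eigenvalue `λ`):

  `2 f₂ - (2μ₁ - 2m + 4) f₁ + (μ₁² - iμ₁μ₂ - μ₂²/2 + 2μ₁ + m²/2 - μ₁m - 2m - λ) f + 2 (θ₁ - iθ₂)(θ₁ + iθ₂) e^{2y} f = 0`.

[cite: JacquetLanglands1970, §6] [cite: Knapp1986, Ch. VIII §3] -/
theorem kirillovODE_complex_lowest {ℓ : archGardingSpace hcpt τ →ₗ[ℂ] ℂ} {θ₁ θ₂ : ℂ}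
    (hθ₁ : ∀ u : archGardingSpace hcpt τ, ℓ (D (Matrix.single 0 1 𝐜) u) = θ₁ * ℓ u)
    (hθ₂ : ∀ u : archGardingSpace hcpt τ, ℓ (D (Matrix.single 0 1 𝐜I) u) = θ₂ * ℓ u)
    (μ₁ μ₂ m lam : ℂ) (v : archGardingSpace hcpt τ)
    (hF : D (Matrix.single 0 1 𝐜 - Matrix.single 1 0 𝐜) v + Complex.I • D (Matrix.single 0 1 𝐜I + Matrix.single 1 0 𝐜I) v = 0)
    (hT : D (Matrix.single 0 0 𝐜I - Matrix.single 1 1 𝐜I) v = (Complex.I * m) • v)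
    (hZ1 : D (Matrix.single 0 0 𝐜 + Matrix.single 1 1 𝐜) v = μ₁ • v)
    (hZ2 : D (Matrix.single 0 0 𝐜I + Matrix.single 1 1 𝐜I) v = μ₂ • v)
    (hC : ∑ i : Fin 2, ∑ j : Fin 2, Dh[i,j] (Dh[j,i] v) = lam • v) (y : ℝ) :
    2 * ℓ (A[y] (D Hc (D Hc v))) - (2 * μ₁ - 2 * m + 4) * ℓ (A[y] (D Hc v)) +
      (μ₁ ^ 2 - Complex.I * μ₁ * μ₂ - μ₂ ^ 2 / 2 + 2 * μ₁ + m ^ 2 / 2 - μ₁ * m - 2 * m - lam) * ℓ (A[y] v) +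
        2 * ((θ₁ - Complex.I * θ₂) * (θ₁ + Complex.I * θ₂)) * (Real.exp y : ℂ) ^ 2 * ℓ (A[y] v) = 0 := by
  obtain ⟨hQ, hM⟩ := lowest_conversions hτ w μ₂ m v hT hZ2 hF
  -- `τ^h(E₀₀) v + τ^h(E₁₁) v = (μ₁ - iμ₂) v`
  have hZh : Dh[0,0] v + Dh[1,1] v = (μ₁ - Complex.I * μ₂) • v := by
    have h1 : D (Matrix.single 0 0 𝐜) v + D (Matrix.single 1 1 𝐜) v = μ₁ • v := by
      rwa [gardingEnd_add, LinearMap.add_apply] at hZ1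
    have h2 : D (Matrix.single 0 0 𝐜I) v + D (Matrix.single 1 1 𝐜I) v = μ₂ • v := by
      rwa [gardingEnd_add, LinearMap.add_apply] at hZ2
    simp only [LinearMap.sub_apply, LinearMap.smul_apply]
    rw [sub_smul, mul_smul, ← h1, ← h2, smul_add]
    abel
  have hcas := placeCasimirHol_apply_of_lowest hτ w (μ₁ - Complex.I * μ₂) v hZh hM
  rw [hC] at hcas
  obtain ⟨hh, ha⟩ := gardingAct_expGLC_mul_hol01 (hcpt := hcpt) (τ := τ) hτ w y
  -- `τ(E₀₀ ⊗ ic)` commutes with `τ(E₀₀ ⊗ c)`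
  have hQc : D (Matrix.single 0 0 𝐜I) * D Hc = D Hc * D (Matrix.single 0 0 𝐜I) := by
    rw [gardingEnd_mul_eq hτ, Matrix.single_mul_single_same, Matrix.single_mul_single_same,
      complexIdem_mul_complexIdemI, complexIdemI_mul_complexIdem, sub_self, gardingEnd_zero, add_zero]
  -- treat the letters as atoms
  set H0 : Module.End ℂ (archGardingSpace hcpt τ) := Dh[0,0] with hH0d
  set Ph : Module.End ℂ (archGardingSpace hcpt τ) := Dh[0,1] with hPhd
  set P : Module.End ℂ (archGardingSpace hcpt τ) := Da[0,1] with hPd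
  set q : ℂ := (μ₂ + Complex.I * m) / 2 with hq
  -- `τ^h(E₀₀) v = τ(H) v - iq v` and its square
  have hH0 : H0 v = D Hc v - (Complex.I * q) • v := by
    rw [hH0d, LinearMap.sub_apply, LinearMap.smul_apply, hQ, smul_smul]
  have hH0sq : H0 (H0 v) = D Hc (D Hc v) - (2 * (Complex.I * q)) • D Hc v + ((Complex.I * q) * (Complex.I * q)) • v := by
    have hQH : D (Matrix.single 0 0 𝐜I) (D Hc v) = q • D Hc v := by
      have h := congrArg (fun T => T v) hQc
      simp only [Module.End.mul_apply] at h
      rw [h, hQ, map_smul]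
    have hstep : H0 (D Hc v) = D Hc (D Hc v) - (Complex.I * q) • D Hc v := by
      rw [hH0d, LinearMap.sub_apply, LinearMap.smul_apply, hQH, smul_smul]
    conv_lhs => rw [hH0]
    rw [map_sub, map_smul, hstep, hH0, smul_sub, smul_smul]
    module
  -- the `E₀₁`-terms: both `τ^h(E₀₁)` and `τ^a(E₀₁)` are multiplications in the Kirillov model
  have hPhℓ : ∀ x : archGardingSpace hcpt τ, ℓ (Ph x) = (θ₁ - Complex.I * θ₂) * ℓ x := fun x => by
    rw [hPhd, LinearMap.sub_apply, LinearMap.smul_apply, map_sub, map_smul, hθ₁, hθ₂, smul_eq_mul]; ring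
  have hXh : ∀ u : archGardingSpace hcpt τ, ℓ (A[y] (Ph u)) = (Real.exp y : ℂ) * (θ₁ - Complex.I * θ₂) * ℓ (A[y] u) := by
    intro u
    have h1 := congrArg (fun T => ℓ (T u)) hh
    simp only [Module.End.mul_apply, LinearMap.smul_apply, map_smul, smul_eq_mul] at h1
    rw [h1, hPhℓ]; ring
  have hPℓ : ∀ x : archGardingSpace hcpt τ, ℓ (P x) = (θ₁ + Complex.I * θ₂) * ℓ x := fun x => by
    rw [hPd, LinearMap.add_apply, LinearMap.smul_apply, map_add, map_smul, hθ₁, hθ₂, smul_eq_mul]; ring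
  have hXa : ∀ u : archGardingSpace hcpt τ, ℓ (A[y] (P u)) = (Real.exp y : ℂ) * (θ₁ + Complex.I * θ₂) * ℓ (A[y] u) := by
    intro u
    have h1 := congrArg (fun T => ℓ (T u)) ha
    simp only [Module.End.mul_apply, LinearMap.smul_apply, map_smul, smul_eq_mul] at h1
    rw [h1, hPℓ]; ring
  -- apply `ℓ ∘ τ(exp yH)` to the Casimir identity
  have h := congrArg (fun u : archGardingSpace hcpt τ => ℓ (A[y] u)) hcas
  have hH0' := congrArg (fun u : archGardingSpace hcpt τ => ℓ (A[y] u)) hH0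
  have hH0sq' := congrArg (fun u : archGardingSpace hcpt τ => ℓ (A[y] u)) hH0sq
  simp only [map_add, map_sub, map_smul, smul_eq_mul] at h hH0' hH0sq'
  simp only [hXa, hXh, hH0', hH0sq'] at h
  rw [hq] at h
  linear_combination -h + (2 * m * ℓ (A[y] (D Hc v)) +
    (-(μ₂ ^ 2) / 2 + (1 - Complex.I ^ 2) * m ^ 2 / 2 - μ₁ * m - 2 * m) * ℓ (A[y] v)) * Complex.I_sq

end ODE

/-! ### 3. The `K`-Bessel solution and its Mellin transform -/

section Bessel

variable {hcpt : isCompact_glFiniteIntegralLevel 2 K}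
  {E : Type*} [NormedAddCommGroup E] [NormedSpace ℂ E] [CompleteSpace E]
  {τ : ContRepresentation ℂ (AutomorphyDatum.gl 2 K hcpt).arch.carrier E}
  (hτ : τ.IsStronglyContinuous) (w : {w : InfinitePlace K // IsComplex w})

local notation "𝐜" => ((0, Pi.single w 1) : mixedSpace K)
local notation "𝐜I" => ((0, Pi.single w Complex.I) : mixedSpace K)
local notation "Hc" => Matrix.single (0 : Fin 2) (0 : Fin 2) ((0, Pi.single w 1) : mixedSpace K)
local notation "D" => gardingEnd (hcpt := hcpt) (τ := τ) hτ
local notation "A[" y "]" => gardingAct (hcpt := hcpt) (τ := τ) hτ (expGL ((y : ℝ) • Hc))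
local notation "Dh[" i "," j "]" => (gardingEnd (hcpt := hcpt) (τ := τ) hτ (Matrix.single (i : Fin 2) (j : Fin 2) ((0, Pi.single w 1) : mixedSpace K)) -
  Complex.I • gardingEnd (hcpt := hcpt) (τ := τ) hτ (Matrix.single (i : Fin 2) (j : Fin 2) ((0, Pi.single w Complex.I) : mixedSpace K)))

/-- **The Kirillov function of a lowest `SU(2)_w`-weight Casimir eigenvector along a complex place is a
`K`-Bessel function**: with the hypotheses of `kirillovODE_complex_lowest`, `τ` acting by contractions,
`ℓ` continuous for the `U(𝔤)`-seminorms, `(θ₁ - iθ₂)(θ₁ + iθ₂) = -a²` (`a > 0`) and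
`λ = (μ₁ - iμ₂)²/2 - 2ν² - 2`, there is `c ∈ ℂ` with
`ℓ(τ(exp yH) v) = c e^{(μ₁-m+1)y/2} besselMode a ν (e^y)` for all `y`. [cite: JacquetLanglands1970, §6]
[cite: Knapp1986, Ch. VIII §3] -/
theorem exists_apply_gardingAct_expGLC_eq_besselMode_of_lowest (hτb : ∀ g, ‖(τ g : E →L[ℂ] E)‖ ≤ 1)
    {ℓ : archGardingSpace hcpt τ →ₗ[ℂ] ℂ}
    (hℓ : ∃ (C : ℝ) (𝒮 : Finset (List (Matrix (Fin 2) (Fin 2) (mixedSpace K)))), 0 ≤ C ∧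
      ∀ v : archGardingSpace hcpt τ, ‖ℓ v‖ ≤ C * ∑ w ∈ 𝒮, ‖archWordDerivE hcpt τ w v‖)
    {θ₁ θ₂ : ℂ} (hθ₁ : ∀ u : archGardingSpace hcpt τ, ℓ (D (Matrix.single 0 1 𝐜) u) = θ₁ * ℓ u)
    (hθ₂ : ∀ u : archGardingSpace hcpt τ, ℓ (D (Matrix.single 0 1 𝐜I) u) = θ₂ * ℓ u)
    {a : ℝ} (ha : 0 < a) (hθa : (θ₁ - Complex.I * θ₂) * (θ₁ + Complex.I * θ₂) = -((a : ℂ) ^ 2))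
    (μ₁ μ₂ m lam ν : ℂ) (hlam : lam = (μ₁ - Complex.I * μ₂) ^ 2 / 2 - 2 * ν ^ 2 - 2) (v : archGardingSpace hcpt τ)
    (hF : D (Matrix.single 0 1 𝐜 - Matrix.single 1 0 𝐜) v + Complex.I • D (Matrix.single 0 1 𝐜I + Matrix.single 1 0 𝐜I) v = 0)
    (hT : D (Matrix.single 0 0 𝐜I - Matrix.single 1 1 𝐜I) v = (Complex.I * m) • v)
    (hZ1 : D (Matrix.single 0 0 𝐜 + Matrix.single 1 1 𝐜) v = μ₁ • v)
    (hZ2 : D (Matrix.single 0 0 𝐜I + Matrix.single 1 1 𝐜I) v = μ₂ • v)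
    (hC : ∑ i : Fin 2, ∑ j : Fin 2, Dh[i,j] (Dh[j,i] v) = lam • v) :
    ∃ c : ℂ, ∀ y : ℝ, ℓ (A[y] v) = c * (Real.exp y : ℂ) ^ ((μ₁ - m + 1) / 2) * besselMode a ν (Real.exp y) := by
  -- the differential equation, rewritten with `θ = ia`
  have hIa : (Complex.I * a) ^ 2 = -((a : ℂ) ^ 2) := by rw [mul_pow, Complex.I_sq]; ring
  have hode : ∀ y : ℝ, 2 * ℓ (A[y] (D Hc (D Hc v))) - (2 * (μ₁ - m + 1) + 2) * ℓ (A[y] (D Hc v)) +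
      (μ₁ ^ 2 - Complex.I * μ₁ * μ₂ - μ₂ ^ 2 / 2 + 2 * μ₁ + m ^ 2 / 2 - μ₁ * m - 2 * m - lam) * ℓ (A[y] v) +
        2 * (Complex.I * a) ^ 2 * (Real.exp y : ℂ) ^ 2 * ℓ (A[y] v) = 0 := fun y => by
    have h := kirillovODE_complex_lowest hτ w hθ₁ hθ₂ μ₁ μ₂ m lam v hF hT hZ1 hZ2 hC y
    rw [hθa] at h
    rw [hIa]
    linear_combination h
  -- derivatives
  have hf : ∀ y : ℝ, HasDerivAt (fun x : ℝ => ℓ (A[x] v)) (ℓ (A[y] (D Hc v))) y :=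
    fun y => hasDerivAt_apply_gardingAct_expGLC hτ w hℓ v y
  have hf₁ : ∀ y : ℝ, HasDerivAt (fun x : ℝ => ℓ (A[x] (D Hc v))) (ℓ (A[y] (D Hc (D Hc v)))) y :=
    fun y => hasDerivAt_apply_gardingAct_expGLC hτ w hℓ (D Hc v) y
  -- growth
  obtain ⟨M, N, hM, hb⟩ := exists_norm_apply_gardingAct_le hτ hτb hℓ Hc v
  have hgrow' : ∀ y : ℝ, 0 ≤ y → ‖ℓ (A[y] v)‖ ≤ M * Real.exp (((2 * N : ℕ) : ℝ) * y) := fun y hy => by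
    have h := hb (expGL (y • Hc)) (Real.exp (-y) - 1) (Real.exp y - 1) (coe_expGL_smul_hZeroC_inv w y)
      (coe_expGL_smul_hZeroC w y)
    have key : (1 + |Real.exp (-y) - 1|) * (1 + |Real.exp y - 1|) ≤ Real.exp |y| ^ 2 := by
      have h1 := one_add_abs_exp_sub_one_le (-y)
      rw [abs_neg] at h1
      have h2 := one_add_abs_exp_sub_one_le y
      have h0 : 0 ≤ 1 + |Real.exp (-y) - 1| := by positivity
      nlinarith
    calc ‖ℓ (A[y] v)‖ ≤ ((1 + |Real.exp (-y) - 1|) * (1 + |Real.exp y - 1|)) ^ N * M := h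
      _ ≤ (Real.exp |y| ^ 2) ^ N * M := by gcongr
      _ = M * Real.exp ((2 * N : ℕ) * y) := by rw [abs_of_nonneg hy, Real.exp_nat_mul, pow_mul, mul_comm]
  have hν : ν ^ 2 + 1 / 4 = (μ₁ ^ 2 - Complex.I * μ₁ * μ₂ - μ₂ ^ 2 / 2 + 2 * μ₁ + m ^ 2 / 2 - μ₁ * m - 2 * m - lam) / 2 -
      (μ₁ - m + 1) ^ 2 / 4 - (μ₁ - m + 1) / 2 := by
    rw [hlam]
    have hI := Complex.I_sq
    linear_combination (μ₂ ^ 2 / 4) * hI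
  exact exists_eq_const_mul_exp_mul_besselMode_of_growth (f := fun x : ℝ => ℓ (A[x] v))
    (f₁ := fun x : ℝ => ℓ (A[x] (D Hc v))) (f₂ := fun x : ℝ => ℓ (A[x] (D Hc (D Hc v)))) hf hf₁ ha hIa hode
    hgrow' ν hν

/-- **… and its Mellin transform** (`integral_cpow_mul_besselMode`, `μ = μ₁ - m + 1`). [cite: JacquetLanglands1970, §6] -/
theorem exists_apply_gardingAct_expGLC_eq_besselMode_of_lowest_and_mellin (hτb : ∀ g, ‖(τ g : E →L[ℂ] E)‖ ≤ 1)
    {ℓ : archGardingSpace hcpt τ →ₗ[ℂ] ℂ}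
    (hℓ : ∃ (C : ℝ) (𝒮 : Finset (List (Matrix (Fin 2) (Fin 2) (mixedSpace K)))), 0 ≤ C ∧
      ∀ v : archGardingSpace hcpt τ, ‖ℓ v‖ ≤ C * ∑ w ∈ 𝒮, ‖archWordDerivE hcpt τ w v‖)
    {θ₁ θ₂ : ℂ} (hθ₁ : ∀ u : archGardingSpace hcpt τ, ℓ (D (Matrix.single 0 1 𝐜) u) = θ₁ * ℓ u)
    (hθ₂ : ∀ u : archGardingSpace hcpt τ, ℓ (D (Matrix.single 0 1 𝐜I) u) = θ₂ * ℓ u)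
    {a : ℝ} (ha : 0 < a) (hθa : (θ₁ - Complex.I * θ₂) * (θ₁ + Complex.I * θ₂) = -((a : ℂ) ^ 2))
    (μ₁ μ₂ m lam ν : ℂ) (hlam : lam = (μ₁ - Complex.I * μ₂) ^ 2 / 2 - 2 * ν ^ 2 - 2) (v : archGardingSpace hcpt τ)
    (hF : D (Matrix.single 0 1 𝐜 - Matrix.single 1 0 𝐜) v + Complex.I • D (Matrix.single 0 1 𝐜I + Matrix.single 1 0 𝐜I) v = 0)
    (hT : D (Matrix.single 0 0 𝐜I - Matrix.single 1 1 𝐜I) v = (Complex.I * m) • v)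
    (hZ1 : D (Matrix.single 0 0 𝐜 + Matrix.single 1 1 𝐜) v = μ₁ • v)
    (hZ2 : D (Matrix.single 0 0 𝐜I + Matrix.single 1 1 𝐜I) v = μ₂ • v)
    (hC : ∑ i : Fin 2, ∑ j : Fin 2, Dh[i,j] (Dh[j,i] v) = lam • v) :
    ∃ c : ℂ, (∀ y : ℝ, ℓ (A[y] v) = c * (Real.exp y : ℂ) ^ ((μ₁ - m + 1) / 2) * besselMode a ν (Real.exp y)) ∧
      ∀ S : ℂ, |ν.im| < (S + (μ₁ - m + 1) / 2).re →
        ∫ u in Ioi (0 : ℝ), ℓ (A[Real.log u] v) * (u : ℂ) ^ (S - 1 / 2 - 1) =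
          c * (2 * ((a : ℂ) ^ (-(S + (μ₁ - m + 1) / 2)) * ((2 : ℂ) ^ (S + (μ₁ - m + 1) / 2 - 2) *
            Complex.Gamma ((S + (μ₁ - m + 1) / 2 + Complex.I * ν) / 2) *
              Complex.Gamma ((S + (μ₁ - m + 1) / 2 - Complex.I * ν) / 2)))) := by
  obtain ⟨c, hc⟩ := exists_apply_gardingAct_expGLC_eq_besselMode_of_lowest hτ w hτb hℓ hθ₁ hθ₂ ha hθa μ₁ μ₂ m lam ν
    hlam v hF hT hZ1 hZ2 hC
  refine ⟨c, hc, fun S hS => ?_⟩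
  rw [← integral_cpow_mul_besselMode ha hS, ← MeasureTheory.integral_const_mul]
  refine setIntegral_congr_fun measurableSet_Ioi fun u hu => ?_
  rw [hc (Real.log u), Real.exp_log hu]
  ring

end Bessel

end Literature.NumberTheory.Automorphic
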